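import Literature.NumberTheory.Transcendental.ChudnovskyHeights
import Mathlib.Algebra.Polynomial.Div
import Mathlib.Algebra.Polynomial.BigOperators
import Mathlib.Algebra.Ring.GeomSum
import HarnessLib

/-!
# Roy's small value estimate for `𝔾ₐ × 𝔾ₘ` — Lemma 3.2 (truncated inverse of `∏ (1 - rᵢ X)^{eᵢ}`)

Topic `Literature/NumberTheory/Transcendental`. Second instalment of the formalisation of the proof
of Roy 2013, Theorem 1.1 (named fact `roy2013_thm_1_1`, `RoySmallValueEstimates.lean`): the
one-variable **Lemma 3.2** of D. Roy, *A small value estimate for `𝔾ₐ × 𝔾ₘ`*, Mathematika 59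
(2013) 333–363 = arXiv:1301.0663, §3 (p. 8 of the arXiv text), which feeds the interpolation
estimate Proposition 3.3:

> Let `r₁, …, r_s ∈ ℂ` and `e₀, e₁, …, e_s ∈ ℕ*`. Put `R = max{1, |r₁|, …, |r_s|}` and
> `E = e₀ + e₁ + ⋯ + e_s`. Then there is a unique polynomial `a(X) ∈ ℂ[X]` of degree `< e₀` with
> `a(X) ∏ᵢ (1 - rᵢ X)^{eᵢ} ≡ 1 mod X^{e₀}`, and its length satisfies `𝓛(a) ≤ binom(E-1, e₀-1) R^{e₀-1}`.

We prove the existence part in the case `R = 1` (all `|rᵢ| ≤ 1`, the only case used in the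
paper, where `rᵢ = 1/(k - s)` with `k ≠ s` integers) with the bound `𝓛(a) ≤ 2^{E-1}`
(`≥ binom(E-1, e₀-1)`; Roy immediately weakens his bound to `2^M ≥ 2^{E-1}` in (3.4), so nothing
is lost downstream): `exists_truncInverse`. Uniqueness is not needed and not formalised. The
length `𝓛` of a univariate complex polynomial (sum of the moduli of the coefficients) is the tree's
`Chudnovsky.pwnorm (normRingSeminorm ℂ)`.

Proof (as printed): `a` is the truncation below degree `e₀` of `∏ᵢ (1 + rᵢX + rᵢ²X² + ⋯)^{eᵢ}`;
its coefficients are dominated by those of `(1 + X + X² + ⋯)^{E - e₀}`, and the sum of the first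
`e₀` of these is `binom(E-1, e₀-1) ≤ 2^{E-1}` (here: the Pascal-type recursion
`S(n+1, m) = S(n+1, m-1) + S(n, m)` for `S(n, m) = ∑_{j<m} [X^j] (∑_{i<e₀} X^i)^n`, `m ≤ e₀`, and
`S(n, m) ≤ 2^{n+m-1}`).

Everything here is proved; no definitions, no new named facts.

## References

* [Roy2013] D. Roy, *A small value estimate for 𝔾ₐ × 𝔾ₘ*, Mathematika 59 (2013), 333–363
  (arXiv:1301.0663), §3, Lemma 3.2.
-/

noncomputable section

open Polynomial Finset

namespace Literature.NumberTheory.Transcendental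

namespace Roy2013

open Chudnovsky

/-! ### Coefficientwise domination -/

/-- Domination `|pⱼ| ≤ Pⱼ` (all `j`) is stable under products. [folklore] -/
theorem dom_mul {p q : ℂ[X]} {P Q : ℝ[X]} (hp : ∀ j, ‖p.coeff j‖ ≤ P.coeff j)
    (hq : ∀ j, ‖q.coeff j‖ ≤ Q.coeff j) (j : ℕ) : ‖(p * q).coeff j‖ ≤ (P * Q).coeff j := by
  rw [coeff_mul, coeff_mul]
  refine (norm_sum_le _ _).trans (Finset.sum_le_sum fun x _ => ?_)
  rw [norm_mul]
  exact mul_le_mul (hp _) (hq _) (norm_nonneg _) ((norm_nonneg _).trans (hp _))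

/-- `1` is dominated by `1`. [folklore] -/
theorem dom_one (j : ℕ) : ‖(1 : ℂ[X]).coeff j‖ ≤ (1 : ℝ[X]).coeff j := by
  rw [coeff_one, coeff_one]
  split_ifs <;> simp

/-- Domination is stable under powers. [folklore] -/
theorem dom_pow {p : ℂ[X]} {P : ℝ[X]} (hp : ∀ j, ‖p.coeff j‖ ≤ P.coeff j) (n : ℕ) (j : ℕ) :
    ‖(p ^ n).coeff j‖ ≤ (P ^ n).coeff j := by
  induction n generalizing j with
  | zero => rw [pow_zero, pow_zero]; exact dom_one j
  | succ n ih => rw [pow_succ, pow_succ]; exact dom_mul ih hp j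

/-- Domination is stable under finite products. [folklore] -/
theorem dom_prod {ι : Type*} (s : Finset ι) {p : ι → ℂ[X]} {P : ι → ℝ[X]}
    (h : ∀ i ∈ s, ∀ j, ‖(p i).coeff j‖ ≤ (P i).coeff j) (j : ℕ) :
    ‖(∏ i ∈ s, p i).coeff j‖ ≤ (∏ i ∈ s, P i).coeff j := by
  classical
  induction s using Finset.induction_on generalizing j with
  | empty => rw [prod_empty, prod_empty]; exact dom_one j
  | insert a s ha ih =>
    rw [prod_insert ha, prod_insert ha]
    exact dom_mul (h a (mem_insert_self a s)) (fun j => ih (fun i hi => h i (mem_insert_of_mem hi)) j) j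

/-! ### The truncated geometric series `∑_{j<e₀} (rX)^j` and its majorant `∑_{j<e₀} X^j` -/

/-- Coefficients of `∑_{i<e₀} (C r · X)^i`. [folklore] -/
theorem coeff_geomTrunc (r : ℂ) (e₀ j : ℕ) :
    (∑ i ∈ range e₀, (C r * X) ^ i : ℂ[X]).coeff j = if j < e₀ then r ^ j else 0 := by
  rw [finsetSum_coeff]
  simp_rw [mul_pow, ← C_pow, coeff_C_mul_X_pow]
  rw [Finset.sum_ite_eq]
  simp only [mem_range]

/-- Coefficients of the majorant `∑_{i<e₀} X^i ∈ ℝ[X]`. [folklore] -/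
theorem coeff_geomOne (e₀ j : ℕ) :
    (∑ i ∈ range e₀, X ^ i : ℝ[X]).coeff j = if j < e₀ then 1 else 0 := by
  rw [finsetSum_coeff]
  simp_rw [coeff_X_pow]
  rw [Finset.sum_ite_eq]
  simp only [mem_range]

/-- For `|r| ≤ 1`, `∑_{i<e₀} (rX)^i` is dominated by `∑_{i<e₀} X^i`. [folklore] -/
theorem dom_geomTrunc {r : ℂ} (hr : ‖r‖ ≤ 1) (e₀ j : ℕ) :
    ‖(∑ i ∈ range e₀, (C r * X) ^ i : ℂ[X]).coeff j‖ ≤ (∑ i ∈ range e₀, X ^ i : ℝ[X]).coeff j := by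
  rw [coeff_geomTrunc, coeff_geomOne]
  split_ifs
  · rw [norm_pow]; exact pow_le_one₀ (norm_nonneg _) hr
  · rw [norm_zero]

/-- `(∑_{i<e₀} (rX)^i)(1 - rX) - 1 = -(rX)^{e₀}` is divisible by `X^{e₀}`. [folklore] -/
theorem X_pow_dvd_geomTrunc_mul_sub_one (r : ℂ) (e₀ : ℕ) :
    (X ^ e₀ : ℂ[X]) ∣ (∑ i ∈ range e₀, (C r * X) ^ i) * (1 - C r * X) - 1 := by
  rw [geom_sum_mul_neg, sub_sub_cancel_left, mul_pow, ← C_pow, dvd_neg]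
  exact Dvd.intro_left _ rfl

/-! ### Divisibility of `∏ fᵢ^{eᵢ} - 1` -/

/-- `d ∣ f - 1` and `d ∣ g - 1` give `d ∣ fg - 1`. [folklore] -/
theorem dvd_mul_sub_one {R : Type*} [CommRing R] {d f g : R} (hf : d ∣ f - 1) (hg : d ∣ g - 1) :
    d ∣ f * g - 1 := by
  have : f * g - 1 = (f - 1) * g + (g - 1) := by ring
  rw [this]
  exact dvd_add (dvd_mul_of_dvd_left hf g) hg

/-- `d ∣ f - 1` gives `d ∣ f^n - 1`. [folklore] -/
theorem dvd_pow_sub_one' {R : Type*} [CommRing R] {d f : R} (hf : d ∣ f - 1) (n : ℕ) :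
    d ∣ f ^ n - 1 := by
  induction n with
  | zero => simp
  | succ n ih => rw [pow_succ]; exact dvd_mul_sub_one ih hf

/-- `d ∣ fᵢ - 1` for all `i` gives `d ∣ ∏ fᵢ^{eᵢ} - 1`. [folklore] -/
theorem dvd_prod_pow_sub_one {R ι : Type*} [CommRing R] (s : Finset ι) {d : R} {f : ι → R}
    (e : ι → ℕ) (hf : ∀ i ∈ s, d ∣ f i - 1) : d ∣ ∏ i ∈ s, f i ^ e i - 1 := by
  classical
  induction s using Finset.induction_on with
  | empty => simp
  | insert a s ha ih =>
    rw [prod_insert ha]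
    exact dvd_mul_sub_one (dvd_pow_sub_one' (hf a (mem_insert_self a s)) _)
      (ih fun i hi => hf i (mem_insert_of_mem hi))

/-! ### The partial sums `S(n, m) = ∑_{j<m} [X^j] (∑_{i<e₀} X^i)^n` -/

/-- Pascal-type recursion: for `1 ≤ m ≤ e₀`,
`[X^{m-1}] F^{n+1} = ∑_{j<m} [X^j] F^n` where `F = ∑_{i<e₀} X^i`. [folklore] -/
theorem coeff_geomOne_pow_succ {e₀ m : ℕ} (hm : m < e₀) (n : ℕ) :
    ((∑ i ∈ range e₀, X ^ i : ℝ[X]) ^ (n + 1)).coeff m =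
      ∑ j ∈ range (m + 1), ((∑ i ∈ range e₀, X ^ i : ℝ[X]) ^ n).coeff j := by
  rw [pow_succ', coeff_mul, Nat.sum_antidiagonal_eq_sum_range_succ_mk, ← sum_range_reflect]
  refine Finset.sum_congr rfl fun k hk => ?_
  rw [mem_range] at hk
  rw [coeff_geomOne, if_pos (by omega), one_mul]
  congr 1
  omega

/-- `S(n, m) ≤ 2^{n+m-1}` for `m ≤ e₀` (written as `≤ 2^{n+m}/2`). [folklore] -/
theorem sum_coeff_geomOne_pow_le (e₀ : ℕ) :
    ∀ n m : ℕ, m ≤ e₀ →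
      ∑ j ∈ range m, ((∑ i ∈ range e₀, X ^ i : ℝ[X]) ^ n).coeff j ≤ (2 : ℝ) ^ (n + m) / 2 := by
  intro n
  induction n with
  | zero =>
    intro m hm
    rcases Nat.eq_zero_or_pos m with rfl | hm0
    · simp
    · rw [pow_zero, zero_add]
      have : ∑ j ∈ range m, (1 : ℝ[X]).coeff j = 1 := by
        rw [Finset.sum_eq_single_of_mem 0 (mem_range.mpr hm0)]
        · simp
        · intro j _ hj
          rw [coeff_one, if_neg hj]
      rw [this, le_div_iff₀ (by norm_num : (0 : ℝ) < 2), one_mul]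
      calc (2 : ℝ) = 2 ^ 1 := by norm_num
        _ ≤ 2 ^ m := pow_le_pow_right₀ (by norm_num) hm0
  | succ n ih =>
    intro m
    induction m with
    | zero => intro _; simp; positivity
    | succ m ihm =>
      intro hm
      rw [Finset.sum_range_succ, coeff_geomOne_pow_succ (by omega) n]
      calc ∑ j ∈ range m, ((∑ i ∈ range e₀, X ^ i : ℝ[X]) ^ (n + 1)).coeff j +
            ∑ j ∈ range (m + 1), ((∑ i ∈ range e₀, X ^ i : ℝ[X]) ^ n).coeff j
          ≤ (2 : ℝ) ^ (n + 1 + m) / 2 + (2 : ℝ) ^ (n + (m + 1)) / 2 :=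
            add_le_add (ihm (by omega)) (ih (m + 1) hm)
        _ = (2 : ℝ) ^ (n + 1 + (m + 1)) / 2 := by ring

/-! ### Lemma 3.2 -/

/-- **Roy 2013, Lemma 3.2** (existence, case `R = 1`, bound weakened from `binom(E-1, e₀-1)` to
`2^{E-1}`): for `r : ι → ℂ` with `|rᵢ| ≤ 1` on `s`, exponents `eᵢ`, and `e₀ ≥ 1`, there is
`a ∈ ℂ[X]` of degree `< e₀` with `a · ∏_{i∈s} (1 - rᵢ X)^{eᵢ} ≡ 1 mod X^{e₀}` and
`𝓛(a) ≤ 2^{e₀ + ∑ eᵢ - 1}`. [cite: Roy2013, Lemma 3.2] -/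
theorem exists_truncInverse {ι : Type*} (s : Finset ι) (r : ι → ℂ) (e : ι → ℕ) {e₀ : ℕ}
    (he₀ : 0 < e₀) (hr : ∀ i ∈ s, ‖r i‖ ≤ 1) :
    ∃ a : ℂ[X], a.natDegree < e₀ ∧
      (X ^ e₀ : ℂ[X]) ∣ a * ∏ i ∈ s, (1 - C (r i) * X) ^ e i - 1 ∧
      pwnorm (normRingSeminorm ℂ) a ≤ (2 : ℝ) ^ (e₀ + ∑ i ∈ s, e i - 1) := by
  classical
  -- the full inverse modulo `X^{e₀}` and its truncation
  set u : ι → ℂ[X] := fun i => ∑ j ∈ range e₀, (C (r i) * X) ^ j with hu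
  set at' : ℂ[X] := ∏ i ∈ s, u i ^ e i with hat
  set a : ℂ[X] := ∑ j ∈ range e₀, monomial j (at'.coeff j) with ha
  have ha_coeff : ∀ j, a.coeff j = if j < e₀ then at'.coeff j else 0 := by
    intro j
    rw [ha, finsetSum_coeff]
    simp_rw [coeff_monomial]
    rw [Finset.sum_ite_eq']
    simp only [mem_range]
  have hdeg : a.natDegree < e₀ := by
    refine Nat.lt_of_le_pred he₀ (natDegree_sum_le_of_forall_le _ _ fun j hj => ?_)
    exact (natDegree_monomial_le _).trans (Nat.le_pred_of_lt (mem_range.mp hj))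
  refine ⟨a, hdeg, ?_, ?_⟩
  · -- divisibility
    have h1 : (X ^ e₀ : ℂ[X]) ∣ at' - a := by
      rw [X_pow_dvd_iff]
      intro d hd
      rw [coeff_sub, ha_coeff, if_pos hd, sub_self]
    have h2 : (X ^ e₀ : ℂ[X]) ∣ at' * ∏ i ∈ s, (1 - C (r i) * X) ^ e i - 1 := by
      rw [hat, ← prod_mul_distrib]
      simp_rw [← mul_pow]
      exact dvd_prod_pow_sub_one s e fun i _ => X_pow_dvd_geomTrunc_mul_sub_one (r i) e₀
    have : a * ∏ i ∈ s, (1 - C (r i) * X) ^ e i - 1 =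
        (at' * ∏ i ∈ s, (1 - C (r i) * X) ^ e i - 1) -
          (at' - a) * ∏ i ∈ s, (1 - C (r i) * X) ^ e i := by ring
    rw [this]
    exact dvd_sub h2 (dvd_mul_of_dvd_left h1 _)
  · -- length
    have hdom : ∀ j, ‖at'.coeff j‖ ≤
        ((∑ i ∈ range e₀, X ^ i : ℝ[X]) ^ (∑ i ∈ s, e i)).coeff j := by
      intro j
      rw [← prod_pow_eq_pow_sum, hat]
      exact dom_prod s (fun i hi j => dom_pow (fun j => dom_geomTrunc (hr i hi) e₀ j) (e i) j) j
    have hsupp : a.support ⊆ range e₀ := by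
      intro j hj
      rw [mem_range]
      by_contra h
      rw [mem_support_iff, ha_coeff, if_neg h] at hj
      exact hj rfl
    rw [pwnorm_eq_sum_of_subset _ hsupp]
    calc ∑ j ∈ range e₀, normRingSeminorm ℂ (a.coeff j)
        = ∑ j ∈ range e₀, ‖at'.coeff j‖ := Finset.sum_congr rfl fun j hj => by
          rw [ha_coeff, if_pos (mem_range.mp hj)]; rfl
      _ ≤ ∑ j ∈ range e₀, ((∑ i ∈ range e₀, X ^ i : ℝ[X]) ^ (∑ i ∈ s, e i)).coeff j :=
          Finset.sum_le_sum fun j _ => hdom j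
      _ ≤ (2 : ℝ) ^ (∑ i ∈ s, e i + e₀) / 2 := sum_coeff_geomOne_pow_le e₀ _ _ le_rfl
      _ = (2 : ℝ) ^ (e₀ + ∑ i ∈ s, e i - 1) := by
          rw [div_eq_iff (by norm_num : (2 : ℝ) ≠ 0), ← pow_succ]
          congr 1
          omega

end Roy2013

end Literature.NumberTheory.Transcendental
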